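import Mathlib
import HarnessLib
import Summits.ValiantsHypothesis.ValiantsHypothesis.Theses.MonotoneRestoration
import Literature.Computability.AlgebraicComplexity.ArithCircuit
import Literature.Computability.AlgebraicComplexity.ArithCircuitProofs
import Literature.Computability.AlgebraicComplexity.MonotoneStructure
import Literature.Computability.AlgebraicComplexity.PermanentIrreducible
import Literature.ModelTheory.FiniteModelTheory.CkEquiv
import Summits.ValiantsHypothesis.ValiantsHypothesis.Theorems.MonotoneRestorationMonotoneRestorationQPCosetCount
import Summits.ValiantsHypothesis.ValiantsHypothesis.Theorems.MonotoneRestorationMonotoneRestorationQPSymmetricLB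
import Summits.ValiantsHypothesis.ValiantsHypothesis.Theorems.MonotoneRestorationMonotoneRestorationQPSupportSymmetrisation
import Summits.ValiantsHypothesis.ValiantsHypothesis.Theorems.MonotoneRestorationMonotoneRestorationQPSparseRegime
import Summits.ValiantsHypothesis.ValiantsHypothesis.Theorems.MonotoneRestorationMonotoneRestorationQPBeta
import Literature.Computability.AlgebraicComplexity.SymmetricArithCircuit
import Literature.Computability.AlgebraicComplexity.DawarWilsenach2025Proofs
import Literature.GroupTheory.PermutationGroups.SmallIndexSubgroups
import Summits.ValiantsHypothesis.ValiantsHypothesis.Theorems.MonotoneRestorationQP.Negative.LoadBearing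
import Summits.ValiantsHypothesis.ValiantsHypothesis.Theorems.MonotoneRestorationMonotoneRestorationQPPermSupportCount

/-! # TTRL-lite variant V20275 of `MonotoneRestorationQP` / `stub_esymmRowSums_complexity` (stmt-ValiantsHypothesis-15886)

Machine-generated helper (proved); move `lemma_proposal`, op `llm`: a sum of `m + 1` variable
occurrences costs at most `m` addition gates, `L(∑_{j < m+1} X (x j)) ≤ m` (variables are free,
`complexity_X_holds`; one gate per further summand, `complexity_add_le_holds`).
See docs/architecture/ttrl-lite.md. -/

namespace Summit.ValiantsHypothesis.ValiantsHypothesis.Theorems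

open Summit.ValiantsHypothesis.ValiantsHypothesis.Theses.MonotoneRestoration
open Literature.Computability.AlgebraicComplexity

/-- TTRL-lite variant V20275 (lemma_proposal `llm`) of `stub_esymmRowSums_complexity`
(stmt-ValiantsHypothesis-15886): a sum of `m + 1` variables has fan-in-two circuit complexity
at most `m` (induction on `m`: `Fin.sum_univ_castSucc`, `complexity_add_le_holds`,
`complexity_X_holds`); machine-found, kernel-checked. -/
theorem stub_esymmRowSums_complexity_var20275 :
    ∀ (τ : Type) (m : ℕ) (x : Fin (m + 1) → τ),
      complexity (∑ j : Fin (m + 1), (MvPolynomial.X (x j) : MvPolynomial τ NNReal)) ≤ m := by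
  intro τ m
  induction m with
  | zero =>
    intro x
    rw [Fin.sum_univ_one]
    exact le_of_eq (complexity_X_holds (k := NNReal) (σ := τ) (x 0))
  | succ m ih =>
    intro x
    rw [Fin.sum_univ_castSucc]
    calc complexity ((∑ j : Fin (m + 1), (MvPolynomial.X (x (Fin.castSucc j)) : MvPolynomial τ NNReal))
            + MvPolynomial.X (x (Fin.last (m + 1))))
        ≤ complexity (∑ j : Fin (m + 1), (MvPolynomial.X (x (Fin.castSucc j)) : MvPolynomial τ NNReal))
            + complexity (MvPolynomial.X (x (Fin.last (m + 1))) : MvPolynomial τ NNReal) + 1 :=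
          complexity_add_le_holds _ _
      _ ≤ m + 0 + 1 := by
          gcongr
          · exact ih (fun j => x (Fin.castSucc j))
          · exact le_of_eq (complexity_X_holds (k := NNReal) (σ := τ) _)
      _ = m + 1 := by ring

end Summit.ValiantsHypothesis.ValiantsHypothesis.Theorems
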